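import Summits.CriticalPhenomena.PercolationContinuityZ3.Theorems.Transplant.SiteGenOfSurplusTransfer
import HarnessLib

/-!
# SITE percolation: (GEN)_site ⟹ (AG-loc)_site ⟹ `SiteAdditiveGluing`, and the site crux from (S5)_site

Part B of `SiteGenOfSurplusTransfer.lean` (split for the 400-line rule): `siteAGloc_card_of_siteGen`, the statement
`SiteGen.SiteSurplusTransfer` and `siteAdditiveGluing_of_siteSurplusTransfer`, `siteNearOneGluing_of_siteSurplusTransfer`.


builds on p205010 (kernel theorem, internal audit signed; external expert review pending).

With the SITE one-cluster theorem (`SiteBHK.siteClusterCondPosAssoc`, site vdBHK Thm 1.3, part III) in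
the tree, the block-(C) reductions of the p205010 chain above the surplus-transfer inequality (S5)
transplant VERBATIM to site percolation (vertex weights `q`, law `prodBernoulli q` on `Set (Fin n)`,
`u ↔ v` = `siteConn Γ u v`, clusters `C_u = siteCluster Γ ω u`):

  (S5)_site  `P({v ↮ T} ∩ {o ↔ v}) · Sur_v(T) ≤ P(v ↮ T) · Sur_o(T)`  (`v ∉ T`),
  `Sur_u(T) := ∫_{u ↔ T} F(C_u) − Σ_{a ∈ T} P(P^u_a)·m_a`, `m_a = ∫ F(C_a)`, `P^u_a` the first-in-rank patterns;
  (GEN)_site `Σ_{a ∈ A} P(P^o_a)·m_a ≤ ∫_{o ↔ A} F(C_o)`;   (AG-loc)_site = `SiteTransplant.SiteAGloc` (p207293).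

* `SiteGen.siteGen_of_siteSurplusTransfer` — (S5)_site for `|T| ≤ K` ⟹ (GEN)_site for `|A| ≤ K+1`
  (induction on `|A|`: remove the rank-maximal relay, site Thm 1.3 for `C(a_k)` given `a_k ↮ T`,
  maximality of `m_{a_k}`, then (S5)_site at `v = a_k`; `|A| = 1` is Harris);
* `SiteGen.siteAGloc_card_of_siteGen` — (GEN)_site ⟹ (AG-loc)_site (take `F = 1{b ∈ ·}`);
* `SiteGen.SiteSurplusTransfer` (`@[conjecture]`, OUR statement) and
  **`SiteGen.siteAdditiveGluing_of_siteSurplusTransfer : SiteSurplusTransfer → SiteAdditiveGluing`**,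
  `siteNearOneGluing_of_siteSurplusTransfer` — so EVERYTHING ABOVE (S5) in the site finite leg is
  kernel-checked; what remains to re-type is SiteCSH ⟹ (S5D)_site ⟹ (S5)_site (peeling) and SiteCSH itself.

Census (CENSUS.md §4): site GEN / S5 rows 0 violations, n ≤ 5 exhaustive.  Support file
(`--supports stmt-CriticalPhenomena-4575 --as helper`); sorry-free.
[cite: VandenbergHaggstromKahn2005, Thm. 1.3 (p. 6)] [cite: KozmaNitzan2024, Conj. 1 (p. 3), Conj. 4 (p. 32)]
-/

noncomputable section

namespace Summit.CriticalPhenomena.PercolationContinuityZ3.Theorems.Transplant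

namespace SiteGen

open MeasureTheory Set
open Literature.Probability.LatticeModels (prodBernoulli)
open Literature.Probability.Percolation
open Literature.Probability.Percolation.BHK2006 (weight weight_nonneg harris integral_prodBernoulli_eq_sum)
open Summit.CriticalPhenomena.PercolationContinuityZ3.Theorems.SiteTransplant (siteConn mem_siteConn
  SiteAdditiveGluing SiteNearOneGluing SiteAGloc siteAdditiveGluing_card_of_siteAGloc_firstRank
  site_sum_measureReal_firstRank siteNearOneGluing_of_siteAdditiveGluing)
open scoped Classical

variable {n : ℕ} (Γ : SimpleGraph (Fin n))

/-! ### (GEN)_site ⟹ (AG-loc)_site -/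

/-- **(GEN)_site ⟹ (AG-loc)_site**: take `F = 1{b ∈ ·}`, so that `∫ F(C(a)) = P(a ↔ b)` and
`∫_{o ↔ A} F(C(o)) = P(o ↔ A, o ↔ b)`, and use that the patterns partition `{o ↔ A}`
(verbatim `AGloc.agloc_firstRank_of_gen`). [cite: KozmaNitzan2024, Conj. 4 (p. 32), Question 5 (p. 32)] -/
theorem siteAGloc_card_of_siteGen (K : ℕ)
    (hgen : ∀ (n : ℕ) (Γ : SimpleGraph (Fin n)) (q : Fin n → unitInterval) (A : Finset (Fin n)) (o : Fin n)
      (F : Set (Fin n) → ℝ) (r : Fin n → ℕ),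
      A.card ≤ K → (∀ S T : Set (Fin n), S ⊆ T → F S ≤ F T) → (∀ S, 0 ≤ F S) → Set.InjOn r ↑A →
      (∀ a ∈ A, ∀ a' ∈ A, r a < r a' →
        ∫ ω, F (siteCluster Γ ω a) ∂(prodBernoulli q) ≤ ∫ ω, F (siteCluster Γ ω a') ∂(prodBernoulli q)) →
      ∑ a ∈ A, (prodBernoulli q).real
            (siteConn Γ o a ∩ ⋂ a' ∈ A.filter (fun a' => r a' < r a), (siteConn Γ o a')ᶜ : Set (Set (Fin n))) *
          ∫ ω, F (siteCluster Γ ω a) ∂(prodBernoulli q) ≤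
        ∫ ω in (⋃ a ∈ A, siteConn Γ o a), F (siteCluster Γ ω o) ∂(prodBernoulli q)) :
    ∀ (n : ℕ) (Γ : SimpleGraph (Fin n)) (q : Fin n → unitInterval) (A : Finset (Fin n)) (o b : Fin n) (r : Fin n → ℕ),
      A.card ≤ K → Set.InjOn r ↑A →
      (∀ a ∈ A, ∀ a' ∈ A, r a < r a' →
        (prodBernoulli q).real (siteConn Γ a b) ≤ (prodBernoulli q).real (siteConn Γ a' b)) →
      (prodBernoulli q).real ((⋃ a ∈ A, siteConn Γ o a) ∩ (siteConn Γ o b)ᶜ : Set (Set (Fin n))) ≤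
        ∑ a ∈ A, (prodBernoulli q).real
            (siteConn Γ o a ∩ ⋂ a' ∈ A.filter (fun a' => r a' < r a), (siteConn Γ o a')ᶜ : Set (Set (Fin n))) *
          (1 - (prodBernoulli q).real (siteConn Γ a b)) := by
  intro n Γ q A o b r hK hr hcompat
  set μ := prodBernoulli q with hμ
  have hmeas : ∀ S : Set (Set (Fin n)), MeasurableSet S := fun S => MeasurableSet.of_discrete
  set F : Set (Fin n) → ℝ := fun M => if b ∈ M then 1 else 0 with hF
  have hFmono : ∀ S T : Set (Fin n), S ⊆ T → F S ≤ F T := by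
    intro S T hST
    simp only [hF]
    by_cases hS : b ∈ S
    · rw [if_pos hS, if_pos (hST hS)]
    · rw [if_neg hS]
      split_ifs <;> norm_num
  have hF0 : ∀ S, 0 ≤ F S := by
    intro S; simp only [hF]; split_ifs <;> norm_num
  have hFind : ∀ x : Fin n, (fun ω : Set (Fin n) => F (siteCluster Γ ω x)) =
      (siteConn Γ x b : Set (Set (Fin n))).indicator 1 := by
    intro x
    funext ω
    simp only [hF]
    by_cases hω : ω ∈ (siteConn Γ x b : Set (Set (Fin n)))
    · rw [Set.indicator_of_mem hω, Pi.one_apply, if_pos ((mem_siteConn_iff_mem_siteCluster Γ x b ω).1 hω)]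
    · rw [Set.indicator_of_notMem hω, if_neg (fun h => hω ((mem_siteConn_iff_mem_siteCluster Γ x b ω).2 h))]
  have hint : ∀ x : Fin n, ∫ ω, F (siteCluster Γ ω x) ∂μ = μ.real (siteConn Γ x b) := by
    intro x
    rw [hFind x, integral_indicator_one (hmeas _)]
  have hsetint : ∫ ω in (⋃ a ∈ A, siteConn Γ o a), F (siteCluster Γ ω o) ∂μ =
      μ.real ((⋃ a ∈ A, siteConn Γ o a) ∩ siteConn Γ o b : Set (Set (Fin n))) := by
    rw [hFind o, ← integral_indicator (hmeas _), Set.indicator_indicator, integral_indicator_one ((hmeas _).inter (hmeas _))]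
  have hcompat' : ∀ a ∈ A, ∀ a' ∈ A, r a < r a' →
      ∫ ω, F (siteCluster Γ ω a) ∂μ ≤ ∫ ω, F (siteCluster Γ ω a') ∂μ := by
    intro a ha a' ha' hlt
    rw [hint a, hint a']
    exact hcompat a ha a' ha' hlt
  have key := hgen n Γ q A o F r hK hFmono hF0 hr hcompat'
  rw [← hμ] at key
  simp only [hint] at key
  rw [hsetint] at key
  have hsp : μ.real (⋃ a ∈ A, siteConn Γ o a) =
      μ.real ((⋃ a ∈ A, siteConn Γ o a) ∩ siteConn Γ o b : Set (Set (Fin n))) +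
        μ.real ((⋃ a ∈ A, siteConn Γ o a) ∩ (siteConn Γ o b)ᶜ : Set (Set (Fin n))) := by
    rw [← measureReal_inter_add_sdiff (s := ⋃ a ∈ A, (siteConn Γ o a : Set (Set (Fin n)))) (h := measure_ne_top _ _)
      (hmeas (siteConn Γ o b)), Set.sdiff_eq]
  have hsum := site_sum_measureReal_firstRank Γ q A r o hr
  rw [← hμ] at hsum
  have hexp : ∑ a ∈ A, μ.real (siteConn Γ o a ∩ ⋂ a' ∈ A.filter (fun a' => r a' < r a), (siteConn Γ o a')ᶜ : Set (Set (Fin n))) *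
        (1 - μ.real (siteConn Γ a b)) =
      ∑ a ∈ A, μ.real (siteConn Γ o a ∩ ⋂ a' ∈ A.filter (fun a' => r a' < r a), (siteConn Γ o a')ᶜ : Set (Set (Fin n))) -
        ∑ a ∈ A, μ.real (siteConn Γ o a ∩ ⋂ a' ∈ A.filter (fun a' => r a' < r a), (siteConn Γ o a')ᶜ : Set (Set (Fin n))) *
          μ.real (siteConn Γ a b) := by
    rw [← Finset.sum_sub_distrib]
    refine Finset.sum_congr rfl fun a _ => ?_
    ring
  rw [hexp, hsum]
  linarith [key, hsp]

/-! ### The site surplus-transfer statement and the site cruxes from it -/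

/-- **(S5)_site — SITE surplus transfer** (OUR statement; site analogue of the hypothesis `hS5` of
`AGloc.gen_firstRank_of_surplusTransfer`, CHAIN-READ §4 (S5)): on every finite graph with vertex weights,
for every relay set `T`, observers `o` and `v ∉ T`, monotone nonnegative `F` and `m`-compatible injective
rank, `P({v ↮ T} ∩ {o ↔ v}) · Sur_v(T) ≤ P(v ↮ T) · Sur_o(T)`.  In the bond chain it follows from CSH by
peeling (T2); census (CENSUS.md §4, row S5): 0 violations, n ≤ 5. [cite: KozmaNitzan2024, Conj. 4 (p. 32)] -/
@[conjecture] def SiteSurplusTransfer : Prop :=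
  ∀ (n : ℕ) (Γ : SimpleGraph (Fin n)) (q : Fin n → unitInterval) (T : Finset (Fin n)) (o v : Fin n)
    (F : Set (Fin n) → ℝ) (r : Fin n → ℕ),
    v ∉ T → (∀ S S' : Set (Fin n), S ⊆ S' → F S ≤ F S') → (∀ S, 0 ≤ F S) → Set.InjOn r ↑T →
    (∀ a ∈ T, ∀ a' ∈ T, r a < r a' →
      ∫ ω, F (siteCluster Γ ω a) ∂(prodBernoulli q) ≤ ∫ ω, F (siteCluster Γ ω a') ∂(prodBernoulli q)) →
    (prodBernoulli q).real ({ω : Set (Fin n) | ∀ a ∈ T, a ∉ siteCluster Γ ω v} ∩ siteConn Γ o v) *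
        (∫ ω in (⋃ a ∈ T, siteConn Γ v a), F (siteCluster Γ ω v) ∂(prodBernoulli q) -
          ∑ a ∈ T, (prodBernoulli q).real
              (siteConn Γ v a ∩ ⋂ a' ∈ T.filter (fun a' => r a' < r a), (siteConn Γ v a')ᶜ : Set (Set (Fin n))) *
            ∫ ω, F (siteCluster Γ ω a) ∂(prodBernoulli q)) ≤
      (prodBernoulli q).real {ω : Set (Fin n) | ∀ a ∈ T, a ∉ siteCluster Γ ω v} *
        (∫ ω in (⋃ a ∈ T, siteConn Γ o a), F (siteCluster Γ ω o) ∂(prodBernoulli q) -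
          ∑ a ∈ T, (prodBernoulli q).real
              (siteConn Γ o a ∩ ⋂ a' ∈ T.filter (fun a' => r a' < r a), (siteConn Γ o a')ᶜ : Set (Set (Fin n))) *
            ∫ ω, F (siteCluster Γ ω a) ∂(prodBernoulli q))

/-- **`SiteSurplusTransfer ⇒ SiteAGloc`** ((S5)_site ⟹ (GEN)_site ⟹ (AG-loc)_site).
[cite: KozmaNitzan2024, Conj. 4 (p. 32), Question 5 (p. 32)] -/
theorem siteAGloc_of_siteSurplusTransfer (hS5 : SiteSurplusTransfer) : SiteAGloc := by
  intro n Γ q A o b r hr hc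
  refine siteAGloc_card_of_siteGen A.card (fun n' Γ' q' A' o' F r' hA' hF hF0 hr' hc' => ?_) n Γ q A o b r le_rfl hr hc
  rcases Nat.eq_zero_or_pos A.card with h0 | hpos
  · have : A'.card = 0 := by omega
    rw [Finset.card_eq_zero.1 this]
    simp
  · obtain ⟨K, hK⟩ : ∃ K, A.card = K + 1 := ⟨A.card - 1, by omega⟩
    exact siteGen_of_siteSurplusTransfer K (fun n Γ q T o v F r _ => hS5 n Γ q T o v F r) n' Γ' q' A' o' F r'
      (hK ▸ hA') hF hF0 hr' hc'

/-- **`SiteSurplusTransfer ⇒ SiteAdditiveGluing`** — the site crux from (S5)_site alone (everything above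
(S5) in the site finite leg is now kernel-checked). [cite: KozmaNitzan2024, Conj. 1 (p. 3)] -/
theorem siteAdditiveGluing_of_siteSurplusTransfer (hS5 : SiteSurplusTransfer) : SiteAdditiveGluing :=
  SiteTransplant.siteAdditiveGluing_of_siteAGloc (siteAGloc_of_siteSurplusTransfer hS5)

/-- **`SiteSurplusTransfer ⇒ SiteNearOneGluing`** (site Conjecture 3 from (S5)_site, δ = ε/2).
[cite: KozmaNitzan2024, Conj. 3 (p. 15)] -/
theorem siteNearOneGluing_of_siteSurplusTransfer (hS5 : SiteSurplusTransfer) : SiteNearOneGluing :=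
  siteNearOneGluing_of_siteAdditiveGluing (siteAdditiveGluing_of_siteSurplusTransfer hS5)

end SiteGen

end Summit.CriticalPhenomena.PercolationContinuityZ3.Theorems.Transplant
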